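import Summits.MatrixMultiplication.MatrixMultiplication.Theorems.OutsiderSandwichFirstOrder
import HarnessLib

/-!
# Three dimension counts and the second-order condition (toward Flanders' theorem)

Route `OutsiderSandwich` (decomposition cell `decomp-mm`, lens 4 «minimal counterexample /
extremal reduction», gen 28, addendum), support for the aside leaf `BlockOneIsMM`
(stmt-MatrixMultiplication-27147).  The ingredients of a determinant-free proof of Flanders'
theorem (`OutsiderSandwichFlanders`):

* `mulVec_mem_of_basis` — a matrix mapping a basis of `A` into `B` maps `A` into `B`.
* `finrank_le_count_quot` — **count A**: if every `X ∈ P` with `X A ⊆ B` lies in `W`, then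
  `dim P ≤ dim W + dim A · (n − dim B)`.
* `finrank_le_count_val` — **count B**: if `X A ⊆ B` on `P` and every `X ∈ P` with `X A = 0`
  lies in `W`, then `dim P ≤ dim W + dim A · dim B`.
* `finrank_le_count_zero` — **count C**: if `X A = 0` and `X V ⊆ B` on `P`, then
  `dim P ≤ (n − dim A) · dim B`.
* `second_order` — **second-order condition** at a maximal-rank `X₀ ∈ P` (source splitting
  `V = ker X₀ ⊕ U`, target splitting `V = im X₀ ⊕ I'`): if `X ∈ P` maps `U` into `I'`, then
  `X u = 0` whenever `u ∈ U`, `k ∈ ker X₀` and `X₀ u = X k` (else `X₀ + X` is injective on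
  `U ⊕ ℂk`); `second_order_polar` is its polarisation.

## References
* P. Bürgisser, M. Clausen, M. A. Shokrollahi, *Algebraic Complexity Theory*, Springer (1997),
  §17.1. [BurgisserClausenShokrollahi1997]
* D. Coppersmith, S. Winograd, *Matrix multiplication via arithmetic progressions*,
  J. Symbolic Comput. 9 (1990) 251–280, §7. [CoppersmithWinograd1990]
-/

noncomputable section
open scoped BigOperators Matrix
set_option linter.dupNamespace false
set_option autoImplicit false

namespace Summit.MatrixMultiplication.MatrixMultiplication.Theorems.OutsiderSandwichFlandersCounts

variable {ρ : Type} [Fintype ρ] [DecidableEq ρ]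

/-! ## 1. Bases -/

omit [DecidableEq ρ] in
/-- A matrix mapping a basis of `A` into `B` maps `A` into `B`. [folklore] -/
theorem mulVec_mem_of_basis {ι : Type} [Fintype ι] {A B : Submodule ℂ (ρ → ℂ)}
    (b : Module.Basis ι ℂ A) (X : Matrix ρ ρ ℂ) (h : ∀ i, X *ᵥ (b i : ρ → ℂ) ∈ B) :
    ∀ a ∈ A, X *ᵥ a ∈ B := by
  intro a ha
  have hrepr := b.sum_repr ⟨a, ha⟩
  have ha' : a = ∑ i, (b.repr ⟨a, ha⟩ i) • (b i : ρ → ℂ) := by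
    have e := congrArg A.subtype hrepr
    rw [map_sum] at e
    simp only [map_smul, Submodule.subtype_apply] at e
    exact e.symm
  have e : X *ᵥ a = X.mulVecLin a := rfl
  rw [e, ha', map_sum]
  refine B.sum_mem fun i _ => ?_
  rw [map_smul]
  exact B.smul_mem _ (h i)

/-! ## 2. Three counts -/

/-- **Count A.**  If every `X ∈ P` with `X A ⊆ B` lies in `W`, then
`dim P ≤ dim W + dim A · (n − dim B)`. [cite: BurgisserClausenShokrollahi1997, §17.1] -/
theorem finrank_le_count_quot (P W : Submodule ℂ (Matrix ρ ρ ℂ)) (A B : Submodule ℂ (ρ → ℂ))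
    (hW : ∀ X ∈ P, (∀ a ∈ A, X *ᵥ a ∈ B) → X ∈ W) :
    Module.finrank ℂ P ≤
      Module.finrank ℂ W + Module.finrank ℂ A * (Fintype.card ρ - Module.finrank ℂ B) := by
  classical
  obtain ⟨B', hB⟩ := Submodule.exists_isCompl B
  let π : (ρ → ℂ) →ₗ[ℂ] B' := Submodule.projectionOnto B' B hB.symm
  let bA := Module.finBasis ℂ A
  let Φ : P →ₗ[ℂ] (Fin (Module.finrank ℂ A) → B') :=
    LinearMap.pi fun i => π ∘ₗ (LinearMap.applyₗ (bA i : ρ → ℂ)) ∘ₗ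
      (Matrix.toLin' : Matrix ρ ρ ℂ ≃ₗ[ℂ] ((ρ → ℂ) →ₗ[ℂ] (ρ → ℂ))).toLinearMap ∘ₗ P.subtype
  have hΦ : ∀ (X : P) (i : Fin (Module.finrank ℂ A)),
      Φ X i = π ((X : Matrix ρ ρ ℂ) *ᵥ (bA i : ρ → ℂ)) := fun X i => by
    show π (Matrix.toLin' (X : Matrix ρ ρ ℂ) (bA i : ρ → ℂ)) = _
    rw [Matrix.toLin'_apply]
  have hker : (LinearMap.ker Φ).map P.subtype ≤ W := by
    rintro _ ⟨X, hX, rfl⟩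
    refine hW X X.2 (mulVec_mem_of_basis bA _ fun i => ?_)
    have e := congrFun (LinearMap.mem_ker.1 hX) i
    rw [hΦ, Pi.zero_apply, Submodule.projectionOnto_apply_eq_zero_iff] at e
    exact e
  have h1 := LinearMap.finrank_range_add_finrank_ker Φ
  have h2 : Module.finrank ℂ (LinearMap.ker Φ) ≤ Module.finrank ℂ W := by
    rw [← Submodule.finrank_map_subtype_eq P (LinearMap.ker Φ)]
    exact Submodule.finrank_mono hker
  have h3 := Submodule.finrank_le (LinearMap.range Φ)
  have hpi : Module.finrank ℂ (Fin (Module.finrank ℂ A) → B') =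
      Module.finrank ℂ A * Module.finrank ℂ B' := by
    rw [Module.finrank_pi_fintype ℂ, Finset.sum_const, Finset.card_univ, Fintype.card_fin,
      smul_eq_mul]
  rw [hpi] at h3
  have h4 := Submodule.finrank_add_eq_of_isCompl hB
  rw [Module.finrank_fintype_fun_eq_card] at h4
  have h5 : Module.finrank ℂ B' = Fintype.card ρ - Module.finrank ℂ B := by omega
  rw [← h5]
  omega

/-- **Count B.**  If `X A ⊆ B` on `P` and every `X ∈ P` with `X A = 0` lies in `W`, then
`dim P ≤ dim W + dim A · dim B`. [cite: BurgisserClausenShokrollahi1997, §17.1] -/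
theorem finrank_le_count_val (P W : Submodule ℂ (Matrix ρ ρ ℂ)) (A B : Submodule ℂ (ρ → ℂ))
    (hB : ∀ X ∈ P, ∀ a ∈ A, X *ᵥ a ∈ B) (hW : ∀ X ∈ P, (∀ a ∈ A, X *ᵥ a = 0) → X ∈ W) :
    Module.finrank ℂ P ≤ Module.finrank ℂ W + Module.finrank ℂ A * Module.finrank ℂ B := by
  classical
  let bA := Module.finBasis ℂ A
  let φ : Fin (Module.finrank ℂ A) → (P →ₗ[ℂ] (ρ → ℂ)) := fun i =>
    (LinearMap.applyₗ (bA i : ρ → ℂ)) ∘ₗ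
      (Matrix.toLin' : Matrix ρ ρ ℂ ≃ₗ[ℂ] ((ρ → ℂ) →ₗ[ℂ] (ρ → ℂ))).toLinearMap ∘ₗ P.subtype
  have hφ : ∀ (X : P) (i : Fin (Module.finrank ℂ A)),
      φ i X = (X : Matrix ρ ρ ℂ) *ᵥ (bA i : ρ → ℂ) := fun X i => by
    show Matrix.toLin' (X : Matrix ρ ρ ℂ) (bA i : ρ → ℂ) = _
    rw [Matrix.toLin'_apply]
  let Φ : P →ₗ[ℂ] (Fin (Module.finrank ℂ A) → B) :=
    LinearMap.pi fun i => (φ i).codRestrict B fun X => by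
      rw [hφ]; exact hB X X.2 _ (bA i).2
  have hΦ : ∀ (X : P) (i : Fin (Module.finrank ℂ A)),
      (Φ X i : ρ → ℂ) = (X : Matrix ρ ρ ℂ) *ᵥ (bA i : ρ → ℂ) := fun X i => by
    show (φ i X) = _
    rw [hφ]
  have hker : (LinearMap.ker Φ).map P.subtype ≤ W := by
    rintro _ ⟨X, hX, rfl⟩
    refine hW X X.2 fun a ha => ?_
    have h0 : ∀ i, (X : Matrix ρ ρ ℂ) *ᵥ (bA i : ρ → ℂ) ∈ (⊥ : Submodule ℂ (ρ → ℂ)) := by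
      intro i
      have e := congrFun (LinearMap.mem_ker.1 hX) i
      rw [Submodule.mem_bot, ← hΦ, e]
      rfl
    exact (Submodule.mem_bot ℂ).1 (mulVec_mem_of_basis bA _ h0 a ha)
  have h1 := LinearMap.finrank_range_add_finrank_ker Φ
  have h2 : Module.finrank ℂ (LinearMap.ker Φ) ≤ Module.finrank ℂ W := by
    rw [← Submodule.finrank_map_subtype_eq P (LinearMap.ker Φ)]
    exact Submodule.finrank_mono hker
  have h3 := Submodule.finrank_le (LinearMap.range Φ)
  have hpi : Module.finrank ℂ (Fin (Module.finrank ℂ A) → B) =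
      Module.finrank ℂ A * Module.finrank ℂ B := by
    rw [Module.finrank_pi_fintype ℂ, Finset.sum_const, Finset.card_univ, Fintype.card_fin,
      smul_eq_mul]
  rw [hpi] at h3
  omega

/-- **Count C.**  If `X A = 0` and `X V ⊆ B` on `P`, then `dim P ≤ (n − dim A) · dim B`.
[cite: BurgisserClausenShokrollahi1997, §17.1] -/
theorem finrank_le_count_zero (P : Submodule ℂ (Matrix ρ ρ ℂ)) (A B : Submodule ℂ (ρ → ℂ))
    (hA : ∀ X ∈ P, ∀ a ∈ A, X *ᵥ a = 0) (hB : ∀ X ∈ P, ∀ v, X *ᵥ v ∈ B) :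
    Module.finrank ℂ P ≤ (Fintype.card ρ - Module.finrank ℂ A) * Module.finrank ℂ B := by
  classical
  obtain ⟨A', hA'⟩ := Submodule.exists_isCompl A
  let bA := Module.finBasis ℂ A'
  let φ : Fin (Module.finrank ℂ A') → (P →ₗ[ℂ] (ρ → ℂ)) := fun i =>
    (LinearMap.applyₗ (bA i : ρ → ℂ)) ∘ₗ
      (Matrix.toLin' : Matrix ρ ρ ℂ ≃ₗ[ℂ] ((ρ → ℂ) →ₗ[ℂ] (ρ → ℂ))).toLinearMap ∘ₗ P.subtype
  have hφ : ∀ (X : P) (i : Fin (Module.finrank ℂ A')),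
      φ i X = (X : Matrix ρ ρ ℂ) *ᵥ (bA i : ρ → ℂ) := fun X i => by
    show Matrix.toLin' (X : Matrix ρ ρ ℂ) (bA i : ρ → ℂ) = _
    rw [Matrix.toLin'_apply]
  let Φ : P →ₗ[ℂ] (Fin (Module.finrank ℂ A') → B) :=
    LinearMap.pi fun i => (φ i).codRestrict B fun X => by
      rw [hφ]; exact hB X X.2 _
  have hΦ : ∀ (X : P) (i : Fin (Module.finrank ℂ A')),
      (Φ X i : ρ → ℂ) = (X : Matrix ρ ρ ℂ) *ᵥ (bA i : ρ → ℂ) := fun X i => by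
    show (φ i X) = _
    rw [hφ]
  have hinj : Function.Injective Φ := by
    rw [← LinearMap.ker_eq_bot, eq_bot_iff]
    intro X hX
    have h0 : ∀ i, (X : Matrix ρ ρ ℂ) *ᵥ (bA i : ρ → ℂ) ∈ (⊥ : Submodule ℂ (ρ → ℂ)) := by
      intro i
      have e := congrFun (LinearMap.mem_ker.1 hX) i
      rw [Submodule.mem_bot, ← hΦ, e]
      rfl
    have hA'0 := mulVec_mem_of_basis bA _ h0
    have hall : ∀ v : ρ → ℂ, (X : Matrix ρ ρ ℂ) *ᵥ v = 0 := by
      intro v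
      have hv : v ∈ A ⊔ A' := by rw [hA'.sup_eq_top]; exact Submodule.mem_top
      obtain ⟨a, ha, a', ha', rfl⟩ := Submodule.mem_sup.1 hv
      rw [Matrix.mulVec_add, hA X X.2 a ha, (Submodule.mem_bot ℂ).1 (hA'0 a' ha'), add_zero]
    have hX0 : (X : Matrix ρ ρ ℂ) = 0 := by
      have e : Matrix.toLin' (X : Matrix ρ ρ ℂ) = 0 :=
        LinearMap.ext fun v => by rw [Matrix.toLin'_apply, hall, LinearMap.zero_apply]
      exact Matrix.toLin'.map_eq_zero_iff.1 e
    exact (Submodule.mem_bot ℂ).2 (Subtype.ext hX0)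
  have h1 := LinearMap.finrank_le_finrank_of_injective hinj
  have hpi : Module.finrank ℂ (Fin (Module.finrank ℂ A') → B) =
      Module.finrank ℂ A' * Module.finrank ℂ B := by
    rw [Module.finrank_pi_fintype ℂ, Finset.sum_const, Finset.card_univ, Fintype.card_fin,
      smul_eq_mul]
  rw [hpi] at h1
  have h4 := Submodule.finrank_add_eq_of_isCompl hA'
  rw [Module.finrank_fintype_fun_eq_card] at h4
  have h5 : Module.finrank ℂ A' = Fintype.card ρ - Module.finrank ℂ A := by omega
  rw [← h5]
  exact h1

/-! ## 3. The second-order condition -/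

omit [DecidableEq ρ] in
/-- **Second-order condition.**  At a maximal-rank `X₀ ∈ P`, with `V = ker X₀ ⊕ U` and
`V = im X₀ ⊕ I'`: if `X ∈ P` maps `U` into `I'`, then `X u = 0` whenever `u ∈ U`, `X₀ k = 0`
and `X₀ u = X k`. [cite: BurgisserClausenShokrollahi1997, §17.1] -/
theorem second_order (P : Submodule ℂ (Matrix ρ ρ ℂ)) {X₀ : Matrix ρ ρ ℂ} (hX₀ : X₀ ∈ P)
    (hmax : ∀ X ∈ P, X.rank ≤ X₀.rank) {U I' : Submodule ℂ (ρ → ℂ)}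
    (hU : IsCompl (LinearMap.ker X₀.mulVecLin) U)
    (hI : IsCompl (LinearMap.range X₀.mulVecLin) I')
    {X : Matrix ρ ρ ℂ} (hX : X ∈ P) (hW : ∀ u ∈ U, X *ᵥ u ∈ I')
    {k : ρ → ℂ} (hk : X₀ *ᵥ k = 0) {u : ρ → ℂ} (hu : u ∈ U) (hku : X₀ *ᵥ u = X *ᵥ k) :
    X *ᵥ u = 0 := by
  classical
  by_contra hne
  let e : (U × ℂ) →ₗ[ℂ] (ρ → ℂ) := U.subtype.coprod (LinearMap.toSpanSingleton ℂ (ρ → ℂ) k)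
  let g : (U × ℂ) →ₗ[ℂ] (ρ → ℂ) := (X₀ + X).mulVecLin ∘ₗ e
  have hg : ∀ p : U × ℂ, g p = (X₀ *ᵥ ((p.1 : ρ → ℂ) + p.2 • u)) + X *ᵥ (p.1 : ρ → ℂ) := by
    intro p
    show (X₀ + X) *ᵥ ((p.1 : ρ → ℂ) + p.2 • k) = _
    rw [Matrix.add_mulVec, Matrix.mulVec_add, Matrix.mulVec_add, Matrix.mulVec_smul,
      Matrix.mulVec_smul, hk, smul_zero, add_zero, Matrix.mulVec_add, Matrix.mulVec_smul, hku]
    abel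
  have hinj : Function.Injective g := by
    rw [← LinearMap.ker_eq_bot, eq_bot_iff]
    intro p hp
    rw [LinearMap.mem_ker, hg] at hp
    have hxI : X₀ *ᵥ ((p.1 : ρ → ℂ) + p.2 • u) ∈ LinearMap.range X₀.mulVecLin := ⟨_, rfl⟩
    have hyI : X *ᵥ (p.1 : ρ → ℂ) ∈ I' := hW _ p.1.2
    have hx0 : X₀ *ᵥ ((p.1 : ρ → ℂ) + p.2 • u) = 0 := by
      have hx' : X₀ *ᵥ ((p.1 : ρ → ℂ) + p.2 • u) ∈ I' := by
        have e1 : X₀ *ᵥ ((p.1 : ρ → ℂ) + p.2 • u) = -(X *ᵥ (p.1 : ρ → ℂ)) :=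
          eq_neg_of_add_eq_zero_left hp
        rw [e1]
        exact I'.neg_mem hyI
      have hmem : X₀ *ᵥ ((p.1 : ρ → ℂ) + p.2 • u) ∈ LinearMap.range X₀.mulVecLin ⊓ I' :=
        ⟨hxI, hx'⟩
      rw [hI.inf_eq_bot, Submodule.mem_bot] at hmem
      exact hmem
    have hy0 : X *ᵥ (p.1 : ρ → ℂ) = 0 := by
      rw [hx0, zero_add] at hp
      exact hp
    -- `p.1 + p.2 • u ∈ ker X₀ ⊓ U = ⊥`
    have hp1 : (p.1 : ρ → ℂ) = -(p.2 • u) := by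
      have hmem : (p.1 : ρ → ℂ) + p.2 • u ∈ LinearMap.ker X₀.mulVecLin ⊓ U :=
        ⟨LinearMap.mem_ker.2 hx0, U.add_mem p.1.2 (U.smul_mem _ hu)⟩
      rw [hU.inf_eq_bot, Submodule.mem_bot] at hmem
      exact eq_neg_of_add_eq_zero_left hmem
    have hp2 : p.2 = 0 := by
      rw [hp1, Matrix.mulVec_neg, Matrix.mulVec_smul, neg_eq_zero, smul_eq_zero] at hy0
      rcases hy0 with h | h
      · exact h
      · exact absurd h hne
    have hp1' : p.1 = 0 := by
      apply Subtype.ext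
      rw [hp1, hp2, zero_smul, neg_zero]
      rfl
    exact (Submodule.mem_bot ℂ).2 (Prod.ext hp1' hp2)
  have h1 := LinearMap.finrank_range_of_inj hinj
  rw [Module.finrank_prod, Module.finrank_self] at h1
  have h2 : Module.finrank ℂ (LinearMap.range g) ≤ (X₀ + X).rank :=
    Submodule.finrank_mono (LinearMap.range_comp_le_range _ _)
  have h3 := hmax (X₀ + X) (P.add_mem hX₀ hX)
  have h4 := Submodule.finrank_add_eq_of_isCompl hU
  have h5 := LinearMap.finrank_range_add_finrank_ker X₀.mulVecLin
  rw [Module.finrank_fintype_fun_eq_card] at h4 h5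
  unfold Matrix.rank at h2 h3
  omega

omit [DecidableEq ρ] in
/-- **Second-order condition, polarised.** [cite: BurgisserClausenShokrollahi1997, §17.1] -/
theorem second_order_polar (P : Submodule ℂ (Matrix ρ ρ ℂ)) {X₀ : Matrix ρ ρ ℂ} (hX₀ : X₀ ∈ P)
    (hmax : ∀ X ∈ P, X.rank ≤ X₀.rank) {U I' : Submodule ℂ (ρ → ℂ)}
    (hU : IsCompl (LinearMap.ker X₀.mulVecLin) U)
    (hI : IsCompl (LinearMap.range X₀.mulVecLin) I')
    {X X' : Matrix ρ ρ ℂ} (hX : X ∈ P) (hX' : X' ∈ P) (hW : ∀ u ∈ U, X *ᵥ u ∈ I')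
    (hW' : ∀ u ∈ U, X' *ᵥ u ∈ I') {k : ρ → ℂ} (hk : X₀ *ᵥ k = 0) {u u' : ρ → ℂ} (hu : u ∈ U)
    (hu' : u' ∈ U) (hku : X₀ *ᵥ u = X *ᵥ k) (hku' : X₀ *ᵥ u' = X' *ᵥ k) :
    X' *ᵥ u + X *ᵥ u' = 0 := by
  have h1 := second_order P hX₀ hmax hU hI hX hW hk hu hku
  have h2 := second_order P hX₀ hmax hU hI hX' hW' hk hu' hku'
  have h3 := second_order P hX₀ hmax hU hI (P.add_mem hX hX') (fun v hv => by
      rw [Matrix.add_mulVec]; exact I'.add_mem (hW v hv) (hW' v hv)) hk (U.add_mem hu hu')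
    (by rw [Matrix.mulVec_add, Matrix.add_mulVec, hku, hku'])
  rw [Matrix.add_mulVec, Matrix.mulVec_add, Matrix.mulVec_add, h1, h2, zero_add, add_zero,
    add_comm] at h3
  exact h3

end Summit.MatrixMultiplication.MatrixMultiplication.Theorems.OutsiderSandwichFlandersCounts
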